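import Summits.HodgeConjecture.HodgeConjecture.Theorems.F0P3cStCharTSCassHTraceKit    -- ★ (this seat) KIT: product shells, dominance of `z·aᵐ`, coset averages, `smoothTrace_boxChar_prodShell_eq`
import Summits.HodgeConjecture.HodgeConjecture.Theorems.F0P3cStCharTSHSt            -- ★ p847858 «HSt» `steinbergLabel_smoothTrace_eq` (`Tr πSt = Tr i_H(χ_H) − χ_ξ` on test functions)
import Literature.NumberTheory.Automorphic.UnitaryGroupPrincipalSeriesHLattice          -- ★ `cmPrincipalSeriesH_eq_twist_comp_fst` (`rfl`)
import Literature.NumberTheory.Automorphic.SmoothInductionAdmissibleOfCocompact       -- ★ `isAdmissible_cmPrincipalSeries_of_iwasawa`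
import Literature.NumberTheory.Automorphic.UnitaryGroupCMLocalIwasawa                 -- ★ `exists_borel_mul_mem_cmLocalIntegralLevel` (Iwasawa at every finite place)
import Literature.NumberTheory.Automorphic.CMPrincipalSeriesJacquetEvalOne            -- ★ `nonarchimedeanGroup_cmLocal`
import HarnessLib

/-!
# F0 · P3c · line LH6 «StCharTS» — ROAD (D) «DEEP-FL», SLICE (D-b) «CASS-H-TRACE»: the character of the Steinberg label `St_H(ξ_v)` on a deep
# Iwahori shell `𝟙_{K_H b_H K_H}` of `H_v = U(Φ₂)(L⁺_v) × U(Φ₁)(L⁺_v)`, by Casselman's theorem on the `U(Φ₂)`-factor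

Cell `hodgecm-mathlib`, squad F0∕P3b → line LH6 (P3c), crux H413 = `stmt-HodgeConjecture-24833` (lane `--supports … --as helper`); seat LH5-p05 (g2), slice
(D-b) of LH6-p04 (g2)'s road (D) «DEEP-FL» (desk F0P3b-plan (g23) ruling 2026-09-02T04:10:49Z (3); interface `F0/P3b/LH6-p04/g2/ROAD-D.interface.txt`
66a979a605f4c6ab §2).  THEOREMS ONLY, sorry-free, ★-only imports; no definition, no instance, no notation, no named fact.
HONEST LABEL: count-neutral; road (D) is multi-session and discharges only the residual named input «XIG-St» of the LH6 organs (S-i)∕(S-ii); HC_CM is proved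
only modulo the 7 printed citations (2 remaining: hLiu418 = stmt-HodgeConjecture-24832, h413 = stmt-HodgeConjecture-24833) until rung 0 closes.

THE MATHEMATICS ([Rogawski1990, §12.1 case (1) pp. 171–172: `JH(i_H(χ_H)) = {ξ, St_H(ξ)}`; §12.7 p. 193 «by Casselman's theorem χ_π(γ) = χ_{π_N}(γ)»;
[Casselman1977, Thm. 5.2]).  Road (D) exhibits ONE explicit transfer `f^H₀ = c_b · 𝟙_{K_H b_H K_H}` of the `G`-shell `𝟙_{K_n b K_n}` and needs the value of the
Steinberg label `πSt = St_H(ξ_v)` of the (N-1273S) letter on it.  With `K_H = K₂ × K₁`, `b_H = (b₂, z₁)`, `K₂ = 𝓘₂.K n₂` an Iwahori level of the `U(Φ₂)`-factor,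
`b₂ ∈ T₂` dominant (`b₂ = z₂ · 𝓘₂.aᵐ`, `z₂` central, `m ≥ 1`), `K₁ ≤ ker χ_{H,1}` compact open in the abelian `U(Φ₁)_v`, and the level deep enough
(`K_H ≤ ker ξ_v`, `K₂` inside the LEVEL-DEPTH neighbourhood of `i_{U(Φ₂)}(χ_{H,2})`):
`Tr St_H(ξ_v)(𝟙_{K_H b_H K_H}) = Tr i_H(χ_H)(𝟙) − χ_{ξ_v}(𝟙)` (★ HSt) `= ν₂(K₂)·#R₂·ν₁(K₁)·χ_{H,1}(z₁)·tr((i₂χ_{H,2})_N(b₂)) − ν₂(K₂ b₂ K₂)·ν₁(K₁)·ξ_v(b_H)`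
(★ `smoothTrace_twist_comp_fst`: the `χ_{H,1}`-average of the product shell is `ν₁(K₁) χ_{H,1}(z₁) · 𝟙_{K₂ b₂ K₂}`; ★ R2d + ★ LEVEL-DEPTH on the `U(Φ₂)`-factor;
`χ_ξ` of a shell on which `ξ_v` is constant).  The Jacquet trace `tr((i₂χ)_N(b₂))` enters through a MULTISET DATUM `s` with `tr (i₂χ)_N(t) = Σ_{θ ∈ s} θ(t)`
(the shape of ★ `F0P3cStCharTSShellKit.smoothTrace_shell_eq_mul_sum`'s `hs`); BRICK 2 of the slice (separate file) discharges it with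
`s = {δ_{B₂}^{1∕2}χ, δ_{B₂}^{1∕2}·wχ}` (the `U(1,1)` Jacquet filtration, [Casselman1995, L. 7.1.1 (a)] — not yet ★ for `N = 2`), which turns the value into
the interface's `VALUE_H`.  The Iwahori datum `𝓘₂` of `B₂ ≤ U(Φ₂)(L⁺_v)` and the dominance of its ray are BINDERS (no ★ `exists_cmIwahoriDatum` for `N = 2`).

* §1 generic group theory: product shells `K_H b_H K_H = (K₂ b₂ K₂) ×ˢ (K₁ z₁ K₁)`, central double cosets are cosets, dominance of `z · aᵐ` from that of `a`;
* §2 generic measure theory: `∫ 𝟙_{zK} χ = μ(K) χ(z)` (`χ|_K = 1`), `χ_ξ(𝟙_S) = μ(S) ξ(b)` (`ξ` constant on `S`);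
* §3 **`steinbergLabel_smoothTrace_shell_eq`** — the slice (D-b) on the `cmDatum … .Local v` carriers of ★ HSt (= the organs' `HLoc L v`), Haar measure
  `ν₂ ⊗ ν₁` (an arbitrary Haar measure on `H_v` differs by ★ `Representation.smoothTrace_eq_haarScalarFactor_mul_smoothTrace`).

## References
* [Rogawski1990] J. D. Rogawski, *Automorphic Representations of Unitary Groups in Three Variables*, Ann. of Math. Stud. 123 (1990): §12.1 case (1) pp. 171–172;
  §12.7 p. 193, Lemma 12.7.3 p. 195; §4.9 Prop. 4.9.1 p. 55; §13.1 Prop. 13.1.4 p. 199.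
* [Casselman1977] W. Casselman, *Characters and Jacquet modules*, Math. Ann. 230 (1977) 101–105, Thm. 5.2.
* [Casselman1995] W. Casselman, *Introduction to the theory of admissible representations of p-adic reductive groups* (draft 1995), Prop. 1.4.4, §3.3, §4.1, L. 7.1.1.
* [BushnellHenniart2006] C. J. Bushnell, G. Henniart, *The Local Langlands Conjecture for GL(2)*, Grundlehren 335 (2006), §4.1, §9.1.
-/

set_option autoImplicit false
-- the mandated namespace has the single-problem summit's repeated segment (`HodgeConjecture.HodgeConjecture`)
set_option linter.dupNamespace false

noncomputable section

open NumberField IsDedekindDomain MeasureTheory Topology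
open scoped Matrix MatrixGroups Pointwise
open Literature.NumberTheory Literature.NumberTheory.Automorphic Literature.NumberTheory.Automorphic.UnitaryGroup
open Literature.NumberTheory.GaloisRepresentations
open Literature.NumberTheory.Rogawski1990

namespace Summit.HodgeConjecture.HodgeConjecture.Cruxes.H413.F0P3cStCharTSCassHTrace

open Summit.HodgeConjecture.HodgeConjecture.Cruxes.H413.F0P3cStCharTSCassHTraceKit

/-! ## §4 The slice (D-b): `Tr St_H(ξ_v)(𝟙_{K_H b_H K_H})` on `H_v = U(Φ₂)(L⁺_v) × U(Φ₁)(L⁺_v)` -/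

section CM

variable (L : Type) [Field L] [NumberField L] [IsCMField L] (v : HeightOneSpectrum (𝓞 ↥(maximalRealSubfield L)))
  [MeasurableSpace ((cmDatum L 2 (Matrix.of fun i j : Fin 2 => if i.val + j.val + 1 = 2 then (1 : L) else 0)).Local v)]
  [BorelSpace ((cmDatum L 2 (Matrix.of fun i j : Fin 2 => if i.val + j.val + 1 = 2 then (1 : L) else 0)).Local v)]
  [MeasurableSpace ((cmDatum L 1 (Matrix.of fun i j : Fin 1 => if i.val + j.val + 1 = 1 then (1 : L) else 0)).Local v)]
  [BorelSpace ((cmDatum L 1 (Matrix.of fun i j : Fin 1 => if i.val + j.val + 1 = 1 then (1 : L) else 0)).Local v)]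

/-- A subgroup of `GL₁(R)` over a commutative ring is commutative (one matrix entry) — used for `U(Φ₁)(L⁺_v) ≤ GL₁(∏_{w ∣ v} L_w)`.
[cite: Rogawski1990, §4.6 p. 49] -/
theorem subgroup_gl_one_mul_comm {R : Type*} [CommRing R] (S : Subgroup (GL (Fin 1) R)) (x y : ↥S) : x * y = y * x := by
  refine Subtype.ext ?_
  show (x : GL (Fin 1) R) * y = y * x
  refine Units.ext (Matrix.ext fun i j => ?_)
  obtain rfl : j = i := Subsingleton.elim j i
  simp only [Units.val_mul, Matrix.mul_apply, Fintype.sum_subsingleton _ j]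
  exact mul_comm _ _

set_option maxHeartbeats 4000000 in  -- statement-level `whnf` on the CM carriers (HSt's frame + the `U(Φ₂)` Jacquet datum) and ~20 carrier-level rewrites (measured)
set_option synthInstance.maxHeartbeats 400000 in
/-- **SLICE (D-b) «CASS-H-TRACE» — the Steinberg label on a deep `H`-shell.**  At a NON-SPLIT finite place `v`, with Haar measures `ν₂` on `U(Φ₂)(L⁺_v)` and `ν₁` on
`U(Φ₁)(L⁺_v)` and the product measure `ν₂ ⊗ ν₁` on `H_v`, for ANY labels `(π₁, πSt)` of `i_H(χ_H)` attached to `ξ` (★ `HLengthTwoLabels`, the organs' binder `hlab`)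
with `Tr π₁ = χ_{ξ_v}` on test functions (`hπ₁`, w.r.t. `ν₂ ⊗ ν₁`), for an Iwahori datum `𝓘₂` of `B₂ ≤ U(Φ₂)(L⁺_v)` whose ray `𝓘₂.a` is dominant at every level
(`haN`, `haNbar`, `hexh` — the binder shapes of ★ R2d ∕ ★ (T1)), and a Jacquet datum of `i₂(χ_{H,2}) = cmPrincipalSeries L 2 v χ_{H,2}` (finite-dimensional Jacquet
module whose `π_N`-trace is the sum of the characters of the multiset `s`): there is a neighbourhood `U₂ ∋ 1` (★ LEVEL-DEPTH) such that at every level `K₂ = 𝓘₂.K n₂ ⊆ U₂`,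
for every central `z₂ ∈ T₂`, `m ≥ 1`, `b₂ = z₂·𝓘₂.aᵐ`, every left transversal `R₂` of `K₂ ∕ (K₂ ∩ ᵇK₂)`, every compact open `K₁ ≤ ker χ_{H,1}` of `U(Φ₁)(L⁺_v)`, every
`z₁ ∈ U(Φ₁)(L⁺_v)`, provided `K_H = K₂ × K₁ ≤ ker ξ_v`:
`Tr πSt(𝟙_{K_H (b₂,z₁) K_H}) = ν₂(K₂)·#R₂·(ν₁(K₁)·χ_{H,1}(z₁))·Σ_{θ ∈ s} θ(b₂) − ν₂(K₂ b₂ K₂)·ν₁(K₁)·ξ_v(b₂, z₁)`.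
Proof: ★ HSt; ★ `smoothTrace_twist_comp_fst` (the `χ_{H,1}`-average of `𝟙_{K₂b₂K₂} ⊗ 𝟙_{z₁K₁}` is `ν₁(K₁)χ_{H,1}(z₁)·𝟙_{K₂b₂K₂}`, `U(Φ₁)_v` abelian); ★ R2d
`smoothTrace_indicator_shell_eq` at `m = 1` for the dominant `b₂` (§1) with `[V^{K₂}] = V_N` (★ LEVEL-DEPTH); §2 for `χ_ξ`.
[cite: Rogawski1990, §12.1 pp. 171–172; §12.7 p. 193, Lemma 12.7.3 p. 195] [cite: Casselman1977, Thm. 5.2] [cite: Casselman1995, §3.3, §4.1] -/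
theorem steinbergLabel_smoothTrace_shell_eq
    (hns : ∀ w : PlacesOver L v, IsCMField.complexConj L • w.1 = w.1)
    (ν₂ : Measure ((cmDatum L 2 (Matrix.of fun i j : Fin 2 => if i.val + j.val + 1 = 2 then (1 : L) else 0)).Local v))
    [ν₂.IsHaarMeasure] [ν₂.IsMulRightInvariant]
    (ν₁ : Measure ((cmDatum L 1 (Matrix.of fun i j : Fin 1 => if i.val + j.val + 1 = 1 then (1 : L) else 0)).Local v))
    [ν₁.IsHaarMeasure] [ν₁.IsMulRightInvariant]
    (ξ : OneDimAutRepH L)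
    (π₁ πSt : IrrClass (((cmDatum L 2 (Matrix.of fun i j : Fin 2 => if i.val + j.val + 1 = 2 then (1 : L) else 0)).Local v) ×
      ((cmDatum L 1 (Matrix.of fun i j : Fin 1 => if i.val + j.val + 1 = 1 then (1 : L) else 0)).Local v)))
    (hlab : HLengthTwoLabels L v
      (torusCharPair (conjLocal L (IsCMField.complexConj L) v) (cmLocalForm L 2 v) (cmLocalForm_eq_over L 2 v) 0
        ((torusLocalComponent L (IsCMField.complexConj L) v ξ.η).comp
            (quotConj (conjLocal L (IsCMField.complexConj L) v) (conjLocal_conjLocal_cm L v)) *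
          halfModulusChar (UnitaryGroup.LocalRing L v))
        (torusLocalComponent L (IsCMField.complexConj L) v ξ.ψ))
      ((torusLocalComponent L (IsCMField.complexConj L) v ξ.ψ).comp (localDet (IsCMField.complexConj L) v (isUnit_antidiagOne_det L 1))) π₁ πSt)
    (hπ₁ : ∀ fH : ((cmDatum L 2 (Matrix.of fun i j : Fin 2 => if i.val + j.val + 1 = 2 then (1 : L) else 0)).Local v) ×
        ((cmDatum L 1 (Matrix.of fun i j : Fin 1 => if i.val + j.val + 1 = 1 then (1 : L) else 0)).Local v) → ℂ,
      IsLocSmooth fH → π₁.smoothTrace (ν₂.prod ν₁) fH = charDist (ξ.xiLocalChar v) (ν₂.prod ν₁) fH)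
    -- the Iwahori datum of `B₂ ≤ U(Φ₂)(L⁺_v)` and the dominance of its ray (BINDERS; shapes of ★ R2d ∕ ★ (T1) `exists_cmIwahoriDatum`)
    (𝓘₂ : (cmBorelTriple L 2 v).IwahoriDatum)
    (haN : ∀ n, ∀ x ∈ 𝓘₂.K n ⊓ (cmBorelTriple L 2 v).N, 𝓘₂.a * x * 𝓘₂.a⁻¹ ∈ 𝓘₂.K n)
    (haNbar : ∀ n, ∀ x ∈ 𝓘₂.K n ⊓ 𝓘₂.Nbar, 𝓘₂.a⁻¹ * x * 𝓘₂.a ∈ 𝓘₂.K n ⊓ 𝓘₂.Nbar)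
    (hexh : ∀ n, ∀ x ∈ (cmBorelTriple L 2 v).N, ∃ m : ℕ, ∀ m', m ≤ m' → 𝓘₂.a ^ m' * x * (𝓘₂.a ^ m')⁻¹ ∈ 𝓘₂.K n) :
    haveI := locallyCompactSpace_cmBorelU L 2 v
    -- the Jacquet datum of `i₂(χ_{H,2})` (BINDERS; BRICK 2 discharges them with `s = {δ^{1/2}χ, δ^{1/2}wχ}`)
    ∀ (_hfd : FiniteDimensional ℂ ((cmBorelTriple L 2 v).restrict
        (cmPrincipalSeries L 2 v
          (torusCharPair (conjLocal L (IsCMField.complexConj L) v) (cmLocalForm L 2 v) (cmLocalForm_eq_over L 2 v) 0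
            ((torusLocalComponent L (IsCMField.complexConj L) v ξ.η).comp
                (quotConj (conjLocal L (IsCMField.complexConj L) v) (conjLocal_conjLocal_cm L v)) *
              halfModulusChar (UnitaryGroup.LocalRing L v))
            (torusLocalComponent L (IsCMField.complexConj L) v ξ.ψ)))).Coinvariants)
      (s : Multiset (↥(cmBorelTriple L 2 v).M →* ℂˣ)),
      (∀ t : ↥(cmBorelTriple L 2 v).M, LinearMap.trace ℂ _
          ((cmPrincipalSeries L 2 v
            (torusCharPair (conjLocal L (IsCMField.complexConj L) v) (cmLocalForm L 2 v) (cmLocalForm_eq_over L 2 v) 0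
              ((torusLocalComponent L (IsCMField.complexConj L) v ξ.η).comp
                  (quotConj (conjLocal L (IsCMField.complexConj L) v) (conjLocal_conjLocal_cm L v)) *
                halfModulusChar (UnitaryGroup.LocalRing L v))
              (torusLocalComponent L (IsCMField.complexConj L) v ξ.ψ))).jacquetModule (cmBorelTriple L 2 v) t) =
        (s.map fun θ : ↥(cmBorelTriple L 2 v).M →* ℂˣ => ((θ t : ℂˣ) : ℂ)).sum) →
    ∃ U₂ ∈ 𝓝 (1 : ↥(unitaryGroupOfForm (conjLocal L (IsCMField.complexConj L) v) (cmLocalForm L 2 v))),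
      ∀ n₂ : ℕ, ((𝓘₂.K n₂ : Set ↥(unitaryGroupOfForm (conjLocal L (IsCMField.complexConj L) v) (cmLocalForm L 2 v))) ⊆ U₂) →
      ∀ (z₂ : ↥(unitaryGroupOfForm (conjLocal L (IsCMField.complexConj L) v) (cmLocalForm L 2 v))),
        z₂ ∈ Subgroup.center ↥(unitaryGroupOfForm (conjLocal L (IsCMField.complexConj L) v) (cmLocalForm L 2 v)) →
        ∀ (hz₂M : z₂ ∈ (cmBorelTriple L 2 v).M) (m : ℕ), 1 ≤ m →
      ∀ (R₂ : Finset ↥(unitaryGroupOfForm (conjLocal L (IsCMField.complexConj L) v) (cmLocalForm L 2 v))),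
        IsLeftTransversal (𝓘₂.K n₂) (𝓘₂.K n₂ ⊓ ConjAct.toConjAct (z₂ * 𝓘₂.a ^ m) • 𝓘₂.K n₂) R₂ →
      ∀ (K₁ : Subgroup ((cmDatum L 1 (Matrix.of fun i j : Fin 1 => if i.val + j.val + 1 = 1 then (1 : L) else 0)).Local v)),
        IsOpen (K₁ : Set ((cmDatum L 1 (Matrix.of fun i j : Fin 1 => if i.val + j.val + 1 = 1 then (1 : L) else 0)).Local v)) →
        IsCompact (K₁ : Set ((cmDatum L 1 (Matrix.of fun i j : Fin 1 => if i.val + j.val + 1 = 1 then (1 : L) else 0)).Local v)) →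
        (∀ k ∈ K₁, (torusLocalComponent L (IsCMField.complexConj L) v ξ.ψ).comp (localDet (IsCMField.complexConj L) v (isUnit_antidiagOne_det L 1)) k = 1) →
      ∀ (z₁ : (cmDatum L 1 (Matrix.of fun i j : Fin 1 => if i.val + j.val + 1 = 1 then (1 : L) else 0)).Local v),
        (∀ x ∈ ((𝓘₂.K n₂).prod K₁ : Subgroup (↥(unitaryGroupOfForm (conjLocal L (IsCMField.complexConj L) v) (cmLocalForm L 2 v)) × (cmDatum L 1 (Matrix.of fun i j : Fin 1 => if i.val + j.val + 1 = 1 then (1 : L) else 0)).Local v)), ξ.xiLocalChar v x = 1) →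
        πSt.smoothTrace (ν₂.prod ν₁)
            ((DoubleCoset.doubleCoset ((z₂ * 𝓘₂.a ^ m, z₁) : ↥(unitaryGroupOfForm (conjLocal L (IsCMField.complexConj L) v) (cmLocalForm L 2 v)) × (cmDatum L 1 (Matrix.of fun i j : Fin 1 => if i.val + j.val + 1 = 1 then (1 : L) else 0)).Local v)
              (((𝓘₂.K n₂).prod K₁ : Subgroup (↥(unitaryGroupOfForm (conjLocal L (IsCMField.complexConj L) v) (cmLocalForm L 2 v)) × (cmDatum L 1 (Matrix.of fun i j : Fin 1 => if i.val + j.val + 1 = 1 then (1 : L) else 0)).Local v)) : Set (↥(unitaryGroupOfForm (conjLocal L (IsCMField.complexConj L) v) (cmLocalForm L 2 v)) × (cmDatum L 1 (Matrix.of fun i j : Fin 1 => if i.val + j.val + 1 = 1 then (1 : L) else 0)).Local v))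
              (((𝓘₂.K n₂).prod K₁ : Subgroup (↥(unitaryGroupOfForm (conjLocal L (IsCMField.complexConj L) v) (cmLocalForm L 2 v)) × (cmDatum L 1 (Matrix.of fun i j : Fin 1 => if i.val + j.val + 1 = 1 then (1 : L) else 0)).Local v)) : Set (↥(unitaryGroupOfForm (conjLocal L (IsCMField.complexConj L) v) (cmLocalForm L 2 v)) × (cmDatum L 1 (Matrix.of fun i j : Fin 1 => if i.val + j.val + 1 = 1 then (1 : L) else 0)).Local v))).indicator
              fun _ => (1 : ℂ)) =
          (ν₂.real (𝓘₂.K n₂ : Set ↥(unitaryGroupOfForm (conjLocal L (IsCMField.complexConj L) v) (cmLocalForm L 2 v))) : ℂ) * (R₂.card : ℂ) *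
              ((ν₁.real (K₁ : Set ((cmDatum L 1 (Matrix.of fun i j : Fin 1 => if i.val + j.val + 1 = 1 then (1 : L) else 0)).Local v)) : ℂ) *
                (((torusLocalComponent L (IsCMField.complexConj L) v ξ.ψ).comp (localDet (IsCMField.complexConj L) v (isUnit_antidiagOne_det L 1)) z₁ : ℂˣ) : ℂ)) *
              (s.map fun θ : ↥(cmBorelTriple L 2 v).M →* ℂˣ => ((θ ⟨z₂ * 𝓘₂.a ^ m, (cmBorelTriple L 2 v).M.mul_mem hz₂M ((cmBorelTriple L 2 v).M.pow_mem 𝓘₂.a_mem m)⟩ : ℂˣ) : ℂ)).sum -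
            (ν₂.real (DoubleCoset.doubleCoset (z₂ * 𝓘₂.a ^ m) (𝓘₂.K n₂ : Set ↥(unitaryGroupOfForm (conjLocal L (IsCMField.complexConj L) v) (cmLocalForm L 2 v))) (𝓘₂.K n₂ : Set ↥(unitaryGroupOfForm (conjLocal L (IsCMField.complexConj L) v) (cmLocalForm L 2 v)))) : ℂ) *
              (ν₁.real (K₁ : Set ((cmDatum L 1 (Matrix.of fun i j : Fin 1 => if i.val + j.val + 1 = 1 then (1 : L) else 0)).Local v)) : ℂ) *
              ((ξ.xiLocalChar v ((z₂ * 𝓘₂.a ^ m, z₁) : ↥(unitaryGroupOfForm (conjLocal L (IsCMField.complexConj L) v) (cmLocalForm L 2 v)) × (cmDatum L 1 (Matrix.of fun i j : Fin 1 => if i.val + j.val + 1 = 1 then (1 : L) else 0)).Local v) : ℂˣ) : ℂ) := by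
  intro hfd s hs
  -- §0 instances: the `U(Φ₂)`-factor in its `unitaryGroupOfForm` spelling (the spelling of `cmBorelTriple`∕`𝓘₂`), and `U(Φ₁)_v`
  letI iM2 : MeasurableSpace ↥(unitaryGroupOfForm (conjLocal L (IsCMField.complexConj L) v) (cmLocalForm L 2 v)) := ‹MeasurableSpace ((cmDatum L 2 (Matrix.of fun i j : Fin 2 => if i.val + j.val + 1 = 2 then (1 : L) else 0)).Local v)›
  haveI iB2 : BorelSpace ↥(unitaryGroupOfForm (conjLocal L (IsCMField.complexConj L) v) (cmLocalForm L 2 v)) := ‹BorelSpace ((cmDatum L 2 (Matrix.of fun i j : Fin 2 => if i.val + j.val + 1 = 2 then (1 : L) else 0)).Local v)›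
  haveI : LocallyCompactSpace ↥(unitaryGroupOfForm (conjLocal L (IsCMField.complexConj L) v) (cmLocalForm L 2 v)) := locallyCompactSpace_local (IsCMField.complexConj L) 2 _ v
  haveI : SecondCountableTopology ↥(unitaryGroupOfForm (conjLocal L (IsCMField.complexConj L) v) (cmLocalForm L 2 v)) := secondCountableTopology_local (IsCMField.complexConj L) 2 _ v
  haveI : T2Space ↥(unitaryGroupOfForm (conjLocal L (IsCMField.complexConj L) v) (cmLocalForm L 2 v)) := t2Space_cmDatum_local 2 L (Matrix.of fun i j : Fin 2 => if i.val + j.val + 1 = 2 then (1 : L) else 0) v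
  haveI := nonarchimedeanGroup_cmLocal L 2 v
  haveI : NonarchimedeanGroup ((cmDatum L 1 (Matrix.of fun i j : Fin 1 => if i.val + j.val + 1 = 1 then (1 : L) else 0)).Local v) := nonarchimedeanGroup_cmLocal L 1 v
  haveI iH2 : @MeasureTheory.Measure.IsHaarMeasure ↥(unitaryGroupOfForm (conjLocal L (IsCMField.complexConj L) v) (cmLocalForm L 2 v)) _ _ iM2 ν₂ := ‹ν₂.IsHaarMeasure›
  haveI : SigmaCompactSpace ↥(unitaryGroupOfForm (conjLocal L (IsCMField.complexConj L) v) (cmLocalForm L 2 v)) := sigmaCompactSpace_of_locallyCompact_secondCountable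
  haveI : SigmaCompactSpace ((cmDatum L 1 (Matrix.of fun i j : Fin 1 => if i.val + j.val + 1 = 1 then (1 : L) else 0)).Local v) := sigmaCompactSpace_of_locallyCompact_secondCountable
  haveI : SigmaCompactSpace ((cmDatum L 2 (Matrix.of fun i j : Fin 2 => if i.val + j.val + 1 = 2 then (1 : L) else 0)).Local v) := sigmaCompactSpace_of_locallyCompact_secondCountable
  -- §1 the `U(Φ₂)`-principal series: admissible, `N₂` closed; the generic box-shell identity supplies the depth neighbourhood
  have hadm : (cmPrincipalSeries L 2 v (torusCharPair (conjLocal L (IsCMField.complexConj L) v) (cmLocalForm L 2 v) (cmLocalForm_eq_over L 2 v) 0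
            ((torusLocalComponent L (IsCMField.complexConj L) v ξ.η).comp
                (quotConj (conjLocal L (IsCMField.complexConj L) v) (conjLocal_conjLocal_cm L v)) *
              halfModulusChar (UnitaryGroup.LocalRing L v))
            (torusLocalComponent L (IsCMField.complexConj L) v ξ.ψ))).IsAdmissible :=
    isAdmissible_cmPrincipalSeries_of_iwasawa L 2 v (exists_borel_mul_mem_cmLocalIntegralLevel L 2 v) _
  have hN : IsClosed (((cmBorelTriple L 2 v).N : Subgroup ↥(unitaryGroupOfForm (conjLocal L (IsCMField.complexConj L) v) (cmLocalForm L 2 v))) : Set ↥(unitaryGroupOfForm (conjLocal L (IsCMField.complexConj L) v) (cmLocalForm L 2 v))) :=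
    (isClosed_upperUnitriangular (n := 2) (R := LocalRing L v)).preimage continuous_subtype_val
  haveI := hfd
  obtain ⟨U, hU, hbox⟩ := smoothTrace_boxChar_prodShell_eq (G₁ := ((cmDatum L 1 (Matrix.of fun i j : Fin 1 => if i.val + j.val + 1 = 1 then (1 : L) else 0)).Local v)) hadm ((torusLocalComponent L (IsCMField.complexConj L) v ξ.ψ).comp (localDet (IsCMField.complexConj L) v (isUnit_antidiagOne_det L 1))) ν₂ ν₁ (cmBorelTriple L 2 v) hN 𝓘₂ s hs
  refine ⟨U, hU, ?_⟩
  intro n₂ hn₂ z₂ hz₂c hz₂M m hm R₂ hR₂ K₁ hK₁o hK₁c hK₁χ z₁ hlev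
  have hbM : z₂ * 𝓘₂.a ^ m ∈ (cmBorelTriple L 2 v).M := (cmBorelTriple L 2 v).M.mul_mem hz₂M ((cmBorelTriple L 2 v).M.pow_mem 𝓘₂.a_mem m)
  obtain ⟨-, hbcomm, hbN, hbNbar, hbexh⟩ := dominant_central_mul_pow (cmBorelTriple L 2 v) 𝓘₂ hz₂c hz₂M haN haNbar hexh hm
  -- §2 the `H`-shell is a product of a `U(Φ₂)`-shell and a coset of the abelian `U(Φ₁)_v`
  have hK₁comm : ∀ k ∈ K₁, k * z₁ = z₁ * k := fun k _ => subgroup_gl_one_mul_comm _ k z₁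
  have hshell : DoubleCoset.doubleCoset ((z₂ * 𝓘₂.a ^ m, z₁) : ↥(unitaryGroupOfForm (conjLocal L (IsCMField.complexConj L) v) (cmLocalForm L 2 v)) × ((cmDatum L 1 (Matrix.of fun i j : Fin 1 => if i.val + j.val + 1 = 1 then (1 : L) else 0)).Local v))
      (((𝓘₂.K n₂).prod K₁ : Subgroup (↥(unitaryGroupOfForm (conjLocal L (IsCMField.complexConj L) v) (cmLocalForm L 2 v)) × ((cmDatum L 1 (Matrix.of fun i j : Fin 1 => if i.val + j.val + 1 = 1 then (1 : L) else 0)).Local v))) : Set (↥(unitaryGroupOfForm (conjLocal L (IsCMField.complexConj L) v) (cmLocalForm L 2 v)) × ((cmDatum L 1 (Matrix.of fun i j : Fin 1 => if i.val + j.val + 1 = 1 then (1 : L) else 0)).Local v)))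
      (((𝓘₂.K n₂).prod K₁ : Subgroup (↥(unitaryGroupOfForm (conjLocal L (IsCMField.complexConj L) v) (cmLocalForm L 2 v)) × ((cmDatum L 1 (Matrix.of fun i j : Fin 1 => if i.val + j.val + 1 = 1 then (1 : L) else 0)).Local v))) : Set (↥(unitaryGroupOfForm (conjLocal L (IsCMField.complexConj L) v) (cmLocalForm L 2 v)) × ((cmDatum L 1 (Matrix.of fun i j : Fin 1 => if i.val + j.val + 1 = 1 then (1 : L) else 0)).Local v))) =
      DoubleCoset.doubleCoset (z₂ * 𝓘₂.a ^ m) (𝓘₂.K n₂ : Set ↥(unitaryGroupOfForm (conjLocal L (IsCMField.complexConj L) v) (cmLocalForm L 2 v))) (𝓘₂.K n₂ : Set ↥(unitaryGroupOfForm (conjLocal L (IsCMField.complexConj L) v) (cmLocalForm L 2 v))) ×ˢ (z₁ • (K₁ : Set ((cmDatum L 1 (Matrix.of fun i j : Fin 1 => if i.val + j.val + 1 = 1 then (1 : L) else 0)).Local v))) := by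
    rw [doubleCoset_prod, doubleCoset_eq_smul_of_forall_comm K₁ hK₁comm]
  have hS₂o : IsOpen (DoubleCoset.doubleCoset (z₂ * 𝓘₂.a ^ m) (𝓘₂.K n₂ : Set ↥(unitaryGroupOfForm (conjLocal L (IsCMField.complexConj L) v) (cmLocalForm L 2 v))) (𝓘₂.K n₂ : Set ↥(unitaryGroupOfForm (conjLocal L (IsCMField.complexConj L) v) (cmLocalForm L 2 v)))) := by
    unfold DoubleCoset.doubleCoset; exact (𝓘₂.isOpen_K n₂).mul_left
  have hS₂c : IsCompact (DoubleCoset.doubleCoset (z₂ * 𝓘₂.a ^ m) (𝓘₂.K n₂ : Set ↥(unitaryGroupOfForm (conjLocal L (IsCMField.complexConj L) v) (cmLocalForm L 2 v))) (𝓘₂.K n₂ : Set ↥(unitaryGroupOfForm (conjLocal L (IsCMField.complexConj L) v) (cmLocalForm L 2 v)))) :=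
    ((𝓘₂.isCompact_K n₂).mul isCompact_singleton).mul (𝓘₂.isCompact_K n₂)
  have hSo : IsOpen (DoubleCoset.doubleCoset (z₂ * 𝓘₂.a ^ m) (𝓘₂.K n₂ : Set ↥(unitaryGroupOfForm (conjLocal L (IsCMField.complexConj L) v) (cmLocalForm L 2 v))) (𝓘₂.K n₂ : Set ↥(unitaryGroupOfForm (conjLocal L (IsCMField.complexConj L) v) (cmLocalForm L 2 v))) ×ˢ (z₁ • (K₁ : Set ((cmDatum L 1 (Matrix.of fun i j : Fin 1 => if i.val + j.val + 1 = 1 then (1 : L) else 0)).Local v)))) :=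
    hS₂o.prod (hK₁o.smul z₁)
  have hSc : IsCompact (DoubleCoset.doubleCoset (z₂ * 𝓘₂.a ^ m) (𝓘₂.K n₂ : Set ↥(unitaryGroupOfForm (conjLocal L (IsCMField.complexConj L) v) (cmLocalForm L 2 v))) (𝓘₂.K n₂ : Set ↥(unitaryGroupOfForm (conjLocal L (IsCMField.complexConj L) v) (cmLocalForm L 2 v))) ×ˢ (z₁ • (K₁ : Set ((cmDatum L 1 (Matrix.of fun i j : Fin 1 => if i.val + j.val + 1 = 1 then (1 : L) else 0)).Local v)))) :=
    hS₂c.prod (hK₁c.smul z₁)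
  rw [hshell]
  have hfH : IsLocSmooth ((DoubleCoset.doubleCoset (z₂ * 𝓘₂.a ^ m) (𝓘₂.K n₂ : Set ↥(unitaryGroupOfForm (conjLocal L (IsCMField.complexConj L) v) (cmLocalForm L 2 v))) (𝓘₂.K n₂ : Set ↥(unitaryGroupOfForm (conjLocal L (IsCMField.complexConj L) v) (cmLocalForm L 2 v))) ×ˢ
      (z₁ • (K₁ : Set ((cmDatum L 1 (Matrix.of fun i j : Fin 1 => if i.val + j.val + 1 = 1 then (1 : L) else 0)).Local v)))).indicator fun _ => (1 : ℂ)) := isLocSmooth_indicator hSo hSc.isClosed hSc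
  -- §3 ★ HSt: `Tr πSt = Tr i_H(χ_H) − χ_ξ`; the first term is the generic box-shell identity (`i_H(χ₂ ⊠ χ₁) = i(χ₂) ⊠ χ₁`, `rfl`)
  rw [F0P3cStCharTSHSt.steinbergLabel_smoothTrace_eq L v (ν₂.prod ν₁) ξ hns π₁ πSt hlab hπ₁ _ hfH]
  have e₁ : Representation.smoothTrace (cmPrincipalSeriesH L v (torusCharPair (conjLocal L (IsCMField.complexConj L) v) (cmLocalForm L 2 v) (cmLocalForm_eq_over L 2 v) 0
            ((torusLocalComponent L (IsCMField.complexConj L) v ξ.η).comp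
                (quotConj (conjLocal L (IsCMField.complexConj L) v) (conjLocal_conjLocal_cm L v)) *
              halfModulusChar (UnitaryGroup.LocalRing L v))
            (torusLocalComponent L (IsCMField.complexConj L) v ξ.ψ)) ((torusLocalComponent L (IsCMField.complexConj L) v ξ.ψ).comp (localDet (IsCMField.complexConj L) v (isUnit_antidiagOne_det L 1)))) (ν₂.prod ν₁)
      ((DoubleCoset.doubleCoset (z₂ * 𝓘₂.a ^ m) (𝓘₂.K n₂ : Set ↥(unitaryGroupOfForm (conjLocal L (IsCMField.complexConj L) v) (cmLocalForm L 2 v))) (𝓘₂.K n₂ : Set ↥(unitaryGroupOfForm (conjLocal L (IsCMField.complexConj L) v) (cmLocalForm L 2 v))) ×ˢ (z₁ • (K₁ : Set ((cmDatum L 1 (Matrix.of fun i j : Fin 1 => if i.val + j.val + 1 = 1 then (1 : L) else 0)).Local v)))).indicator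
        fun _ => (1 : ℂ)) =
      (ν₂.real (𝓘₂.K n₂ : Set ↥(unitaryGroupOfForm (conjLocal L (IsCMField.complexConj L) v) (cmLocalForm L 2 v))) : ℂ) * (R₂.card : ℂ) *
        ((ν₁.real (K₁ : Set ((cmDatum L 1 (Matrix.of fun i j : Fin 1 => if i.val + j.val + 1 = 1 then (1 : L) else 0)).Local v)) : ℂ) * ((((torusLocalComponent L (IsCMField.complexConj L) v ξ.ψ).comp (localDet (IsCMField.complexConj L) v (isUnit_antidiagOne_det L 1))) z₁ : ℂˣ) : ℂ)) *
        (s.map fun θ : ↥(cmBorelTriple L 2 v).M →* ℂˣ => ((θ ⟨z₂ * 𝓘₂.a ^ m, hbM⟩ : ℂˣ) : ℂ)).sum :=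
    hbox n₂ hn₂ (z₂ * 𝓘₂.a ^ m) hbM hbcomm (hbN n₂) (hbNbar n₂) (hbexh n₂) R₂ hR₂ K₁ hK₁o hK₁c hK₁χ z₁
  rw [e₁]
  -- §4 the second term: `χ_ξ` of the shell, on which `ξ_v` is constant (`K_H ≤ ker ξ_v`), and the product measure
  have hξconst : ∀ x ∈ DoubleCoset.doubleCoset (z₂ * 𝓘₂.a ^ m) (𝓘₂.K n₂ : Set ↥(unitaryGroupOfForm (conjLocal L (IsCMField.complexConj L) v) (cmLocalForm L 2 v))) (𝓘₂.K n₂ : Set ↥(unitaryGroupOfForm (conjLocal L (IsCMField.complexConj L) v) (cmLocalForm L 2 v))) ×ˢ (z₁ • (K₁ : Set ((cmDatum L 1 (Matrix.of fun i j : Fin 1 => if i.val + j.val + 1 = 1 then (1 : L) else 0)).Local v))),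
      ξ.xiLocalChar v x = ξ.xiLocalChar v ((z₂ * 𝓘₂.a ^ m, z₁) : ↥(unitaryGroupOfForm (conjLocal L (IsCMField.complexConj L) v) (cmLocalForm L 2 v)) × ((cmDatum L 1 (Matrix.of fun i j : Fin 1 => if i.val + j.val + 1 = 1 then (1 : L) else 0)).Local v)) := by
    intro x hx
    rw [← hshell] at hx
    exact apply_eq_of_mem_doubleCoset (ξ.xiLocalChar v) hlev hlev _ hx
  have hνS : (ν₂.prod ν₁).real (DoubleCoset.doubleCoset (z₂ * 𝓘₂.a ^ m) (𝓘₂.K n₂ : Set ↥(unitaryGroupOfForm (conjLocal L (IsCMField.complexConj L) v) (cmLocalForm L 2 v))) (𝓘₂.K n₂ : Set ↥(unitaryGroupOfForm (conjLocal L (IsCMField.complexConj L) v) (cmLocalForm L 2 v))) ×ˢ (z₁ • (K₁ : Set ((cmDatum L 1 (Matrix.of fun i j : Fin 1 => if i.val + j.val + 1 = 1 then (1 : L) else 0)).Local v)))) =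
      ν₂.real (DoubleCoset.doubleCoset (z₂ * 𝓘₂.a ^ m) (𝓘₂.K n₂ : Set ↥(unitaryGroupOfForm (conjLocal L (IsCMField.complexConj L) v) (cmLocalForm L 2 v))) (𝓘₂.K n₂ : Set ↥(unitaryGroupOfForm (conjLocal L (IsCMField.complexConj L) v) (cmLocalForm L 2 v)))) * ν₁.real (K₁ : Set ((cmDatum L 1 (Matrix.of fun i j : Fin 1 => if i.val + j.val + 1 = 1 then (1 : L) else 0)).Local v)) := by
    have h := Measure.prod_prod (μ := ν₂) (ν := ν₁)
      (DoubleCoset.doubleCoset (z₂ * 𝓘₂.a ^ m) (𝓘₂.K n₂ : Set ↥(unitaryGroupOfForm (conjLocal L (IsCMField.complexConj L) v) (cmLocalForm L 2 v))) (𝓘₂.K n₂ : Set ↥(unitaryGroupOfForm (conjLocal L (IsCMField.complexConj L) v) (cmLocalForm L 2 v)))) (z₁ • (K₁ : Set ((cmDatum L 1 (Matrix.of fun i j : Fin 1 => if i.val + j.val + 1 = 1 then (1 : L) else 0)).Local v)))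
    rw [measure_smul_subgroup ν₁ K₁ z₁] at h
    have h' := congrArg ENNReal.toReal h
    rw [ENNReal.toReal_mul] at h'
    exact h'
  have hcd : charDist (ξ.xiLocalChar v) (ν₂.prod ν₁)
      ((DoubleCoset.doubleCoset (z₂ * 𝓘₂.a ^ m) (𝓘₂.K n₂ : Set ↥(unitaryGroupOfForm (conjLocal L (IsCMField.complexConj L) v) (cmLocalForm L 2 v))) (𝓘₂.K n₂ : Set ↥(unitaryGroupOfForm (conjLocal L (IsCMField.complexConj L) v) (cmLocalForm L 2 v))) ×ˢ (z₁ • (K₁ : Set ((cmDatum L 1 (Matrix.of fun i j : Fin 1 => if i.val + j.val + 1 = 1 then (1 : L) else 0)).Local v)))).indicator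
        fun _ => (1 : ℂ)) =
      (ν₂.real (DoubleCoset.doubleCoset (z₂ * 𝓘₂.a ^ m) (𝓘₂.K n₂ : Set ↥(unitaryGroupOfForm (conjLocal L (IsCMField.complexConj L) v) (cmLocalForm L 2 v))) (𝓘₂.K n₂ : Set ↥(unitaryGroupOfForm (conjLocal L (IsCMField.complexConj L) v) (cmLocalForm L 2 v)))) : ℂ) *
        (ν₁.real (K₁ : Set ((cmDatum L 1 (Matrix.of fun i j : Fin 1 => if i.val + j.val + 1 = 1 then (1 : L) else 0)).Local v)) : ℂ) * ((ξ.xiLocalChar v ((z₂ * 𝓘₂.a ^ m, z₁) : ↥(unitaryGroupOfForm (conjLocal L (IsCMField.complexConj L) v) (cmLocalForm L 2 v)) × ((cmDatum L 1 (Matrix.of fun i j : Fin 1 => if i.val + j.val + 1 = 1 then (1 : L) else 0)).Local v)) : ℂˣ) : ℂ) := by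
    have h := charDist_indicator_of_forall_eq (ν₂.prod ν₁) (ξ.xiLocalChar v) hSo.measurableSet hξconst
    rw [hνS, Complex.ofReal_mul] at h
    exact h
  rw [hcd]

end CM

end Summit.HodgeConjecture.HodgeConjecture.Cruxes.H413.F0P3cStCharTSCassHTrace

end
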